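import Mathlib
import HarnessLib.Audit
import Summits.PneNP.PneNP.Theorems.PstarNorUnitPolar
import Summits.PneNP.PneNP.Theorems.PstarNorUnitGraph

/-!
# A NOR-forced chord, III: tools — `𝔽₂²` type facts, the all-minors-zero rank bound, boundary of cycle-plus-gadgets (ROUND-24, memo §9 R7/R8, O5)

FRONTIER range-avoidance ladder, rung F-N3, ROUND 24 (cell `pnp-ideate`, planner memo `r24/CORE-BOUND-NOTES.md` §9 R7 (NOR case) / R8, §10 O5,
§13; restricted-model proof complexity — nothing here bears on `P` versus `NP`).

TOOLS for the theorem `PstarNorUnit.nor_unit` (stated there; recalled here for orientation).  Pure `P⋆` instance with simple overlaps, `(r, 3/2)`-boundary expanding.  Data of ONE forced chord in the NOR case of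
`PstarChordForcing.forced_chord_cases`, read on the instance:
* `P` — the chord's fundamental path family, `e ∉ P` the chord, closing `P` into an XOR cycle (no XOR variable of `P ∪ {e}` on the boundary of
  `P ∪ {e}` — true for the terminal core's fundamental cycles, which are XOR-closed);
* the NOR identity `Q_P + c = μ₁ m₁ + μ₂ m₂` (`μ_i = λ_i + 1`, `m_i` affine) and the rank hypothesis `codim rad B_P ≥ 4` (`PstarPathRank`);
* `G` — outputs disjoint from `P ∪ {e}` REALISING THE LITERAL PRODUCTS: whenever `ℓ₁(e_v)ℓ₂(e_w) + ℓ₁(e_w)ℓ₂(e_v) = 1` (i.e. `{v,w}` is a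
  quadratic monomial of `λ₁λ₂`, equivalently of `q = λ₁λ₂ + 1`, the second constraint), some `g ∈ G` has AND pair `{v, w}` (in the bridge:
  `w₂`'s folded pendants / x-read tree monomials); `#(P ∪ {e} ∪ G) ≤ r`.
CONCLUSION: `P = {j₁, j₂}` with disjoint AND pairs, literals `σ ∈ andPair j₁`, `τ ∈ andPair j₂` such that the literal variables (those with
`ℓ₁(e_v) ≠ 0 ∨ ℓ₂(e_v) ≠ 0`) are EXACTLY `{σ, τ}`, and a gadget `g ∈ G` with AND pair `{σ, τ}`.  So the literal span is spanned by two
COORDINATES (single literals — memo O5's composite classes never occur), the forced path is the CONS-T pair `(σ,b)(τ,b′)`, and the NOR gadget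
`(σ,τ)` exists: exactly the local shape of `PstarLitNorCore.LitNorStructure`.

This file: `lit_of_adj` / `three_profiles` / `det_of_outside` / `det_or_eq` (decided `𝔽₂` facts about types `(π_v, ν_v)`),
`lin_cases` + `rank_lt_of_dets_zero` (all `2×2` minors of `(ℓ₁,ℓ₂)` zero ⟹ `B_P = sym(ℓ ⊗ n')` ⟹ codim rad `≤ 2`, contradicting rank `4`), and
`card_bdry_union_le` (boundary of `P ∪ {e} ∪ G'` for gadgets `G'` on path variables: `≤ 2 + 2|G'| + #uncovered leaves`).
Proof of `nor_unit` (`PstarNorUnitPolar` + `PstarNorUnitGraph` + these tools): rank `B_P = 4` exactly ⟹ no induced 3-matching and no literal off the path;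
expansion of `P ∪ {e}` ⟹ `2K₂` or cherry-plus-edge (`two_edges_or_cherry`); the "type" identity `adj_eq` in `𝔽₂²` plus ONE or TWO gadget
outputs added to `P ∪ {e}` violate `3/2`-expansion in every other case (`7 < 7.5`, `6 < 7.5`), and "all path literals of one profile"
contradicts rank `4` (`rank_lt_of_dets_zero`).  Sanity: exhaustive enumeration of the combinatorial core for `≤ 7` AND variables (kit j307174).
-/

set_option linter.dupNamespace false -- `Summit.PneNP.PneNP.…`: summit = sub-problem name (D-0017 single-conjunct layout)

open Finset Module Literature.Computability.Complexity
open Summit.PneNP.PneNP.Theorems.PstarSALevel (varSet bdry BoundaryExpanding SimpleOverlap)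
open Summit.PneNP.PneNP.Theorems.PstarGapLinearised (andPair andPair_subset_varSet)
open Summit.PneNP.PneNP.Theorems.PstarChordEndgameTools (mem_andPair_iff not_two_shared)
open Summit.PneNP.PneNP.Theorems.PstarCentreFree (vars_mem_varSet)
open Summit.PneNP.PneNP.Theorems.PstarGapOneKills (mem_andPair_of_slot)
open Summit.PneNP.PneNP.Theorems.PstarNorCoreTools (not_mem_bdry_of_two eq_of_mem_bdry xorPair mem_xorPair_iff card_xorPair_le)
open Summit.PneNP.PneNP.Theorems.PstarCubeIdeals (IsAffineFn)
open Summit.PneNP.PneNP.Theorems.PstarQuadRank (rad mem_rad)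
open Summit.PneNP.PneNP.Theorems.PstarRankRigidityTwo (linPart symForm symForm_apply linPart_apply finrank_le_rad_symForm)
open Summit.PneNP.PneNP.Theorems.PstarProductRank (qform polar IsInducedMatching)
open Summit.PneNP.PneNP.Theorems.PstarPathRank (AndAdj and_ne andPair_ne)
open Summit.PneNP.PneNP.Theorems.PstarNorUnitPolar (polar_eq exists_mem_andPair_of_lit adj_eq card_le_two_of_isInducedMatching two_le_card)
open Summit.PneNP.PneNP.Theorems.PstarNorUnitGraph (adeg leafEdges mem_leafEdges eq_of_adeg_eq_one card_leaves_le two_edges_or_cherry)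

namespace Summit.PneNP.PneNP.Theorems.PstarNorUnitTools

variable {n m : ℕ}

/-! ## Small `𝔽₂` facts about types `(π, ν) ∈ 𝔽₂² × 𝔽₂²` -/

/-- **An edge has a literal end**: if the adjacency expression is `1`, one of the two profiles is non-zero. -/
theorem lit_of_adj {a₁ a₂ b₁ b₂ x₁ x₂ y₁ y₂ : ZMod 2} (h : a₁ * y₁ + b₁ * x₁ + (a₂ * y₂ + b₂ * x₂) = 1) :
    (a₁ ≠ 0 ∨ a₂ ≠ 0) ∨ (b₁ ≠ 0 ∨ b₂ ≠ 0) := by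
  revert h a₁ a₂ b₁ b₂ x₁ x₂ y₁ y₂; decide

/-- **Three equal profiles are contradictory**: with `π_x = π_y = π_z = (p₁,p₂)`, the adjacencies `[y~z] = 1`, `[x~y] = 0`, `[x~z] = 0` are
inconsistent (their sum vanishes identically). -/
theorem three_profiles {p₁ p₂ x₁ x₂ y₁ y₂ z₁ z₂ : ZMod 2} (hyz : p₁ * z₁ + p₁ * y₁ + (p₂ * z₂ + p₂ * y₂) = 1)
    (hxy : p₁ * y₁ + p₁ * x₁ + (p₂ * y₂ + p₂ * x₂) = 0) (hxz : p₁ * z₁ + p₁ * x₁ + (p₂ * z₂ + p₂ * x₂) = 0) : False := by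
  revert hyz hxy hxz p₁ p₂ x₁ x₂ y₁ y₂ z₁ z₂; decide

/-- **An outside neighbour separates profiles**: `π_b = 0`, `[σ~b] = 1`, `[v~b] = 0` and `π_v ≠ 0` force `det(π_σ, π_v) = 1`. -/
theorem det_of_outside {s₁ s₂ v₁ v₂ b₁ b₂ ns₁ ns₂ nv₁ nv₂ lb₁ lb₂ : ZMod 2} (hb₁ : lb₁ = 0) (hb₂ : lb₂ = 0)
    (hσ : s₁ * b₁ + lb₁ * ns₁ + (s₂ * b₂ + lb₂ * ns₂) = 1) (hv : v₁ * b₁ + lb₁ * nv₁ + (v₂ * b₂ + lb₂ * nv₂) = 0) (hlit : v₁ ≠ 0 ∨ v₂ ≠ 0) :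
    s₁ * v₂ + v₁ * s₂ = 1 := by
  subst hb₁; subst hb₂
  simp only [zero_mul, add_zero] at hσ hv
  revert hσ hv hlit s₁ s₂ v₁ v₂ b₁ b₂; decide

/-- Two distinct non-zero vectors of `𝔽₂²` are independent: `det = 1` unless the profiles are equal. -/
theorem det_or_eq {s₁ s₂ v₁ v₂ : ZMod 2} (hs : s₁ ≠ 0 ∨ s₂ ≠ 0) (hv : v₁ ≠ 0 ∨ v₂ ≠ 0) :
    s₁ * v₂ + v₁ * s₂ = 1 ∨ (s₁ = v₁ ∧ s₂ = v₂) := by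
  revert hs hv s₁ s₂ v₁ v₂; decide

/-! ## Linear parts with all `2 × 2` minors zero give rank at most two -/

section Dets

variable {μ₁ μ₂ m₁ m₂ : (Fin n → ZMod 2) → ZMod 2} (hμ₁ : IsAffineFn μ₁) (hμ₂ : IsAffineFn μ₂) (hm₁ : IsAffineFn m₁) (hm₂ : IsAffineFn m₂)

/-- If all minors `ℓ₁(e_v)ℓ₂(e_w) + ℓ₁(e_w)ℓ₂(e_v)` vanish then `ℓ₂ = 0`, `ℓ₁ = 0` or `ℓ₁ = ℓ₂`. -/
theorem lin_cases (h : ∀ v w : Fin n, linPart hμ₁ (Pi.single v 1) * linPart hμ₂ (Pi.single w 1) +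
      linPart hμ₁ (Pi.single w 1) * linPart hμ₂ (Pi.single v 1) = 0) :
    linPart hμ₂ = 0 ∨ linPart hμ₁ = 0 ∨ linPart hμ₁ = linPart hμ₂ := by
  have zc : ∀ t : ZMod 2, t = 0 ∨ t = 1 := by decide
  have ext1 : ∀ {f g : (Fin n → ZMod 2) →ₗ[ZMod 2] ZMod 2}, (∀ v, f (Pi.single v 1) = g (Pi.single v 1)) → f = g := by
    intro f g hfg
    refine LinearMap.pi_ext fun i x => ?_
    rcases zc x with rfl | rfl
    · rw [Pi.single_zero, map_zero, map_zero]
    · exact hfg i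
  by_cases h1 : ∃ v, linPart hμ₁ (Pi.single v 1) = 1 ∧ linPart hμ₂ (Pi.single v 1) = 0
  · -- a profile `(1,0)`: every `w` has `ℓ₂(e_w) = 0`
    obtain ⟨v, hv1, hv2⟩ := h1
    left
    refine ext1 fun w => ?_
    have := h v w
    rw [hv1, hv2, one_mul, mul_zero, add_zero] at this
    rw [this, LinearMap.zero_apply]
  by_cases h2 : ∃ v, linPart hμ₁ (Pi.single v 1) = 0 ∧ linPart hμ₂ (Pi.single v 1) = 1
  · obtain ⟨v, hv1, hv2⟩ := h2
    right; left
    refine ext1 fun w => ?_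
    have := h v w
    rw [hv1, hv2, zero_mul, mul_one, zero_add] at this
    rw [this, LinearMap.zero_apply]
  · -- all profiles in `{0, (1,1)}`
    right; right
    push Not at h1 h2
    refine ext1 fun w => ?_
    rcases zc (linPart hμ₁ (Pi.single w 1)) with e1 | e1 <;> rcases zc (linPart hμ₂ (Pi.single w 1)) with e2 | e2
    · rw [e1, e2]
    · exact absurd e2 (h2 w e1)
    · exact absurd e2 (by have := h1 w e1; intro h0; exact this h0)
    · rw [e1, e2]

variable {I : LocalMap 4 n m} {P : Finset (Fin m)} {c : ZMod 2}
  (hQ : ∀ x, qform P (fun j => I.vars j 2) (fun j => I.vars j 3) x + c = μ₁ x * m₁ x + μ₂ x * m₂ x)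

include hm₁ hm₂ hQ

/-- **All minors zero contradict rank four**: then `B_P` is a single symmetric product `sym(ℓ ⊗ n)`, of codimension `≤ 2`. -/
theorem rank_lt_of_dets_zero (h : ∀ v w : Fin n, linPart hμ₁ (Pi.single v 1) * linPart hμ₂ (Pi.single w 1) +
      linPart hμ₁ (Pi.single w 1) * linPart hμ₂ (Pi.single v 1) = 0) :
    ¬ finrank (ZMod 2) (rad (polar P (fun j => I.vars j 2) (fun j => I.vars j 3))) + 4 ≤ finrank (ZMod 2) (Fin n → ZMod 2) := by
  intro hrank
  have hP := polar_eq hμ₁ hμ₂ hm₁ hm₂ hQ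
  -- in each case `B_P = symForm ℓ n'` for suitable `ℓ, n'`
  have key : ∃ ℓ n' : (Fin n → ZMod 2) →ₗ[ZMod 2] ZMod 2, polar P (fun j => I.vars j 2) (fun j => I.vars j 3) = symForm ℓ n' := by
    rcases lin_cases hμ₁ hμ₂ h with h0 | h0 | h0
    · refine ⟨linPart hμ₁, linPart hm₁, ?_⟩
      rw [hP]; refine LinearMap.ext₂ fun x y => ?_
      rw [LinearMap.add_apply, LinearMap.add_apply, symForm_apply, symForm_apply, h0, LinearMap.zero_apply, LinearMap.zero_apply]; ring
    · refine ⟨linPart hμ₂, linPart hm₂, ?_⟩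
      rw [hP]; refine LinearMap.ext₂ fun x y => ?_
      rw [LinearMap.add_apply, LinearMap.add_apply, symForm_apply, symForm_apply, h0, LinearMap.zero_apply, LinearMap.zero_apply]; ring
    · refine ⟨linPart hμ₂, linPart hm₁ + linPart hm₂, ?_⟩
      rw [hP]; refine LinearMap.ext₂ fun x y => ?_
      rw [LinearMap.add_apply, LinearMap.add_apply, symForm_apply, symForm_apply, symForm_apply, h0, LinearMap.add_apply,
        LinearMap.add_apply]; ring
  obtain ⟨ℓ, n', hln⟩ := key
  rw [hln] at hrank
  have := finrank_le_rad_symForm (M := Fin n → ZMod 2) ℓ n'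
  omega

end Dets

/-! ## Boundary accounting for the cycle family plus gadgets -/

section Bdry

variable {I : LocalMap 4 n m} (hS : SimpleOverlap I) {P : Finset (Fin m)} {e : Fin m} (he : e ∉ P)
  (hcyc : ∀ j ∈ insert e P, ∀ s : Fin 4, s.val < 2 → I.vars j s ∉ bdry I (insert e P))

include hcyc in
/-- **Boundary of `P ∪ {e} ∪ G'`** for gadgets `G'` whose AND variables are AND variables of `P`: at most the two AND variables of `e`, two XOR
tips per gadget, and the leaves of `P` not held by a gadget. -/
theorem card_bdry_union_le (G' : Finset (Fin m)) (hG' : Disjoint G' (insert e P))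
    (hgv : ∀ g ∈ G', ∀ v ∈ andPair I g, ∃ j ∈ P, v ∈ andPair I j) :
    (bdry I (insert e P ∪ G')).card ≤
      2 + 2 * G'.card + ((univ.filter fun v => adeg I P v = 1).filter fun v => ∀ g ∈ G', v ∉ andPair I g).card := by
  classical
  set F := insert e P ∪ G' with hF
  have hsub : bdry I F ⊆ andPair I e ∪ G'.biUnion (xorPair I) ∪
      ((univ.filter fun v => adeg I P v = 1).filter fun v => ∀ g ∈ G', v ∉ andPair I g) := by
    intro v hv
    have hv' := hv
    unfold PstarSALevel.bdry at hv'
    rw [mem_filter, card_eq_one] at hv'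
    obtain ⟨j, hj⟩ := hv'.2
    have hjm : j ∈ F.filter fun j => v ∈ varSet I j := by rw [hj]; exact mem_singleton_self j
    rw [mem_filter] at hjm
    obtain ⟨hjF, hvj⟩ := hjm
    have huniq : ∀ j' ∈ F, v ∈ varSet I j' → j' = j := fun j' hj' hvj' => eq_of_mem_bdry I hj' hjF hv hvj' hvj
    have hvj'' := hvj
    unfold PstarSALevel.varSet at hvj''
    obtain ⟨s, -, hs⟩ := mem_image.1 hvj''
    rcases mem_union.1 hjF with hjC | hjG
    · -- `j` on the cycle: XOR slots are excluded, AND slots give `andPair e` or a leaf of `P`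
      by_cases hs2 : s.val < 2
      · exfalso
        refine hcyc j hjC s hs2 ?_
        rw [hs]
        -- `v ∈ bdry (insert e P)` since the only member of `F ⊇ insert e P` reading `v` is `j`
        unfold PstarSALevel.bdry
        rw [mem_filter, card_eq_one]
        refine ⟨mem_univ _, j, ?_⟩
        refine eq_singleton_iff_unique_mem.2 ⟨mem_filter.2 ⟨hjC, hvj⟩, fun j' hj' => ?_⟩
        rw [mem_filter] at hj'
        exact huniq j' (mem_union_left _ hj'.1) hj'.2
      · have hva : v ∈ andPair I j := hs ▸ mem_andPair_of_slot I j s (by omega)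
        rcases mem_insert.1 hjC with rfl | hjP
        · exact mem_union_left _ (mem_union_left _ hva)
        · refine mem_union_right _ (mem_filter.2 ⟨mem_filter.2 ⟨mem_univ _, ?_⟩, fun g hg hvg => ?_⟩)
          · unfold adeg
            refine le_antisymm (card_le_one.2 fun a ha b hb => ?_) (card_pos.2 ⟨j, mem_filter.2 ⟨hjP, hva⟩⟩)
            rw [mem_filter] at ha hb
            rw [huniq a (mem_union_left _ (mem_insert_of_mem ha.1)) (andPair_subset_varSet I a ha.2),
              huniq b (mem_union_left _ (mem_insert_of_mem hb.1)) (andPair_subset_varSet I b hb.2)]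
          · have hgj := huniq g (mem_union_right _ hg) (andPair_subset_varSet I g hvg)
            exact (Finset.disjoint_left.1 hG' hg) (hgj ▸ hjC)
    · -- `j` a gadget: XOR slots are tips; AND slots are path variables, read twice
      by_cases hs2 : s.val < 2
      · refine mem_union_left _ (mem_union_right _ (mem_biUnion.2 ⟨j, hjG, (mem_xorPair_iff I j v).2 ?_⟩))
        have hs' : s.val = 0 ∨ s.val = 1 := by omega
        rcases hs' with h | h
        · exact Or.inl (by rw [← hs]; congr 1; exact Fin.ext h)
        · exact Or.inr (by rw [← hs]; congr 1; exact Fin.ext h)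
      · exfalso
        have hva : v ∈ andPair I j := hs ▸ mem_andPair_of_slot I j s (by omega)
        obtain ⟨j', hj'P, hvj'⟩ := hgv j hjG v hva
        have hjj := huniq j' (mem_union_left _ (mem_insert_of_mem hj'P)) (andPair_subset_varSet I j' hvj')
        exact (Finset.disjoint_left.1 hG' hjG) (hjj ▸ mem_insert_of_mem hj'P)
  calc (bdry I F).card
      ≤ (andPair I e ∪ G'.biUnion (xorPair I) ∪
          ((univ.filter fun v => adeg I P v = 1).filter fun v => ∀ g ∈ G', v ∉ andPair I g)).card := card_le_card hsub
    _ ≤ (andPair I e).card + (G'.biUnion (xorPair I)).card +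
          ((univ.filter fun v => adeg I P v = 1).filter fun v => ∀ g ∈ G', v ∉ andPair I g).card :=
        (card_union_le _ _).trans (Nat.add_le_add_right (card_union_le _ _) _)
    _ ≤ 2 + 2 * G'.card + ((univ.filter fun v => adeg I P v = 1).filter fun v => ∀ g ∈ G', v ∉ andPair I g).card := by
        have h1 : (andPair I e).card ≤ 2 := card_le_two
        have h2 : (G'.biUnion (xorPair I)).card ≤ 2 * G'.card :=
          card_biUnion_le.trans ((sum_le_sum fun g _ => card_xorPair_le I g).trans (by rw [sum_const, smul_eq_mul, mul_comm]))
        omega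

end Bdry

end Summit.PneNP.PneNP.Theorems.PstarNorUnitTools
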